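import Summits.ABC.ABC.Theses.IneffectiveSubspace

/-!
# The `ℤ[i]` normal form of the Pell-square cell: `t + i = μ·ν⁴` (stmt-ABC-14937)

Support file of line `SketchIdeator4` (card
`Cruxes/UniformSadicTowerFour/Ideas/gaussian-thue-pell-square.md`, §First lemma
`GaussianNormalForm`) for crux #2 `UniformSadicTowerFour` of route `IneffectiveSubspace`.  The crux
restricted to the level-4 tower points `x = (1,1,1,1)`, `y = (1,t,1,1)`, `z = (m,1,1,n)` is the
"Pell-square cell" `1 + t² = m·n⁴`; in `ℤ[i]` one has `t² + 1 = N(t + i)`, and this file proves the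
DICTIONARY of the line, unconditionally (no crux hypothesis):

* `gaussianNormalForm` — if `1 + t² = m·n⁴` then `t + i = μ·ν⁴` with `N(ν) = n`, `N(μ) = m`.

So cell points are exactly the solutions of the harmonic quartic Thue equations `Im(μ·ν⁴) = 1`
(`thueSolution_of_cell`; the converse direction is `…HarmonicThue.natAbs_re_sq_add_one_of_im_eq`).

Proof (factorization-free, gcd route).  Put `α = t + i`, so `α·ᾱ = m·n⁴` (`norm_eq_mul_conj`).  The
modulus `n` is odd (`4 ∤ t² + 1`), so `n⁴` is coprime to `2 = −i·(α − ᾱ)`; hence every common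
divisor of `α`, `ᾱ`, `n⁴` is a unit (`isUnit_of_dvd_of_dvd_conj`).  Split `n⁴ = A·B` with `A ∣ α`,
`B ∣ ᾱ` (`exists_dvd_and_dvd_of_dvd_mul`; `ℤ[i]` is a UFD); then `A`, `B` are coprime, so `A ~ ν⁴`
(`exists_associated_pow_of_mul_eq_pow'`), and `ᾱ`-symmetry gives `B ~ Ā`, whence
`N(A) = N(B) = n⁴`, `N(ν) = n`, and `μ := α/ν⁴` has `N(μ) = m`.

Uses only Mathlib (`Zsqrtd`, `GaussianInt`, Bézout/UFD generalities).
-/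

-- `Summit.<Summit>.<Problem>` is the mandated summit-side namespace (CONVENTIONS §2); for the
-- single-conjunct summit `ABC` the two coincide, so the duplicate `ABC.ABC` is deliberate.
set_option linter.dupNamespace false

namespace Summit.ABC.ABC.Theorems.UniformSadicTowerFour.GaussianNormalForm

open Summit.ABC.ABC.Theses.IneffectiveSubspace
open Summit.ABC.ABC.Theorems

/-- The norm of `ℤ[i]` is multiplicative on powers: `N(x^k) = N(x)^k`. [folklore] -/
theorem norm_pow (x : GaussianInt) (k : ℕ) : (x ^ k).norm = x.norm ^ k :=
  map_pow Zsqrtd.normMonoidHom x k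

/-- Squares are `0` or `1 (mod 4)`, so `4 ∤ 1 + t²`. [folklore] -/
theorem not_four_dvd_one_add_sq (t : ℕ) : ¬ 4 ∣ 1 + t ^ 2 := by
  intro h
  have h4 : ((1 + t ^ 2 : ℕ) : ZMod 4) = 0 := (ZMod.natCast_eq_zero_iff _ _).mpr h
  push_cast at h4
  generalize (t : ZMod 4) = x at h4
  revert x
  decide

/-- The modulus of the Pell-square cell is odd: `1 + t² = m·n⁴ ⟹ 2 ∤ n` (else `16 ∣ 1 + t²`).
[folklore] -/
theorem not_two_dvd_of_cell {t m n : ℕ} (h : 1 + t ^ 2 = m * n ^ 4) : ¬ 2 ∣ n := by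
  rintro ⟨k, rfl⟩
  exact not_four_dvd_one_add_sq t ⟨m * k ^ 4 * 4, by rw [h]; ring⟩

/-- `star` preserves divisibility in `ℤ[i]` (it is a ring automorphism). [folklore] -/
theorem star_dvd_star {x y : GaussianInt} (h : x ∣ y) : star x ∣ star y := by
  obtain ⟨c, rfl⟩ := h
  exact Dvd.intro (star c) (star_mul' x c).symm

/-- **Common divisors of `α`, `ᾱ` and an odd fourth power are units.** If `Im α = 1` (so that
`α − ᾱ = 2i`) and `2 ∤ n`, then every `d ∈ ℤ[i]` dividing `α`, `star α` and `n⁴` is a unit: `d ∣ 2`,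
and `n⁴` is coprime to `2`. [folklore] -/
theorem isUnit_of_dvd_of_dvd_conj {α d : GaussianInt} {n : ℕ} (hn : ¬ 2 ∣ n) (hα : α.im = 1)
    (h1 : d ∣ α) (h2 : d ∣ star α) (h3 : d ∣ (n : GaussianInt) ^ 4) : IsUnit d := by
  have hcop : IsCoprime ((n : GaussianInt) ^ 4) 2 := by
    have hc : Nat.Coprime (n ^ 4) 2 :=
      Nat.Coprime.pow_left 4 ((Nat.Prime.coprime_iff_not_dvd Nat.prime_two).mpr hn).symm
    simpa using (Nat.Coprime.isCoprime hc).intCast (R := GaussianInt)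
  refine hcop.isUnit_of_dvd' h3 ?_
  have h4 : d ∣ (α - star α) * ⟨0, -1⟩ := (dvd_sub h1 h2).mul_right _
  have h5 : (α - star α) * (⟨0, -1⟩ : GaussianInt) = 2 := by
    ext <;> simp [hα]
  rwa [h5] at h4

/-- **The `ℤ[i]` normal form of the Pell-square cell** (card gaussian-thue-pell-square, first
lemma).  If `1 + t² = m·n⁴` then `t + i = μ·ν⁴` in `ℤ[i]` with `N(μ) = m` and `N(ν) = n`.  (So `n`
is a sum of two squares and `(μ, ν)` solves the harmonic quartic Thue equation `Im(μ·ν⁴) = 1`.)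
[folklore] -/
theorem gaussianNormalForm : ∀ t m n : ℕ, 1 + t ^ 2 = m * n ^ 4 →
    ∃ μ ν : GaussianInt, μ.norm = m ∧ ν.norm = n ∧ (⟨(t : ℤ), 1⟩ : GaussianInt) = μ * ν ^ 4 := by
  intro t m n h
  have hn0 : n ≠ 0 := by rintro rfl; simp at h
  have hn2 : ¬ 2 ∣ n := not_two_dvd_of_cell h
  have hZ : 1 + (t : ℤ) ^ 2 = m * (n : ℤ) ^ 4 := by exact_mod_cast h
  set α : GaussianInt := ⟨(t : ℤ), 1⟩ with hαdef
  have hαim : α.im = 1 := rfl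
  have hαn : α.norm = m * (n : ℤ) ^ 4 := by
    rw [Zsqrtd.norm_def, ← hZ]
    simp [hαdef]
    ring
  have hN : α * star α = (m : GaussianInt) * (n : GaussianInt) ^ 4 := by
    rw [← Zsqrtd.norm_eq_mul_conj, hαn]
    push_cast
    rfl
  -- every common divisor of `α`, `star α`, `n⁴` is a unit; coprimality of divisors
  have hrel : ∀ x y : GaussianInt, x ∣ α → y ∣ star α → x ∣ (n : GaussianInt) ^ 4 →
      IsCoprime x y := fun x y hx hy hxn =>
    IsRelPrime.isCoprime fun d hdx hdy =>
      isUnit_of_dvd_of_dvd_conj hn2 hαim (hdx.trans hx) (hdy.trans hy) (hdx.trans hxn)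
  -- split `n⁴ = A·B` along `α·ᾱ`
  obtain ⟨A, B, hA, hB, hAB⟩ := exists_dvd_and_dvd_of_dvd_mul
    (show (n : GaussianInt) ^ 4 ∣ α * star α from ⟨m, by rw [hN, mul_comm]⟩)
  have hAn : A ∣ (n : GaussianInt) ^ 4 := ⟨B, hAB⟩
  have hBn : B ∣ (n : GaussianInt) ^ 4 := ⟨A, hAB.trans (mul_comm A B)⟩
  obtain ⟨ν, hν⟩ := exists_associated_pow_of_mul_eq_pow' (hrel A B hA hB hAn) hAB.symm
  obtain ⟨μ, hμ⟩ : ν ^ 4 ∣ α := hν.dvd.trans hA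
  -- `ᾱ`-symmetry: `B ~ star A`, so `N(A) = N(B) = n⁴`
  have hsn : star ((n : GaussianInt) ^ 4) = (n : GaussianInt) ^ 4 := by simp
  have hsA : star A ∣ B := by
    have h2 : star A ∣ A * B := by rw [← hAB, ← hsn]; exact star_dvd_star hAn
    exact (hrel A (star A) hA (star_dvd_star hA) hAn).symm.dvd_of_dvd_mul_left h2
  have hsB : star B ∣ A := by
    have h1 : star B ∣ α := by simpa using star_dvd_star hB
    have h2 : star B ∣ A * B := by rw [← hAB, ← hsn]; exact star_dvd_star hBn
    exact (hrel (star B) B h1 hB (h2.trans ⟨1, by rw [mul_one, hAB]⟩)).dvd_of_dvd_mul_right h2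
  have hassoc : Associated (star A) B :=
    associated_of_dvd_dvd hsA (by simpa using star_dvd_star hsB)
  have hNA : A.norm = B.norm := by
    rw [← Zsqrtd.norm_conj A]
    exact Zsqrtd.norm_eq_of_associated (by norm_num) hassoc
  have hNAB : A.norm * B.norm = ((n : ℤ) ^ 4) ^ 2 := by
    rw [← Zsqrtd.norm_mul, ← hAB, norm_pow, Zsqrtd.norm_natCast]
    ring
  have hNA' : A.norm = (n : ℤ) ^ 4 := by
    rw [← hNA, ← sq] at hNAB
    exact (pow_left_inj₀ (GaussianInt.norm_nonneg A) (by positivity) two_ne_zero).mp hNAB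
  have hNν : ν.norm = n := by
    have h1 : ν.norm ^ 4 = (n : ℤ) ^ 4 := by
      rw [← norm_pow, Zsqrtd.norm_eq_of_associated (by norm_num) hν, hNA']
    exact (pow_left_inj₀ (GaussianInt.norm_nonneg ν) (by positivity) (by norm_num)).mp h1
  refine ⟨μ, ν, ?_, hNν, by rw [hμ, mul_comm]⟩
  -- `N(μ) = m`
  have h1 : (n : ℤ) ^ 4 * μ.norm = (n : ℤ) ^ 4 * (m : ℤ) :=
    calc (n : ℤ) ^ 4 * μ.norm = (ν ^ 4 * μ).norm := by rw [Zsqrtd.norm_mul, norm_pow, hNν]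
      _ = α.norm := by rw [hμ]
      _ = (n : ℤ) ^ 4 * m := by rw [hαn, mul_comm]
  exact mul_left_cancel₀ (pow_ne_zero 4 (Nat.cast_ne_zero.mpr hn0)) h1

/-- **Cell points are Thue solutions.** If `1 + t² = m·n⁴` then there are `μ, ν ∈ ℤ[i]` with
`N(μ) = m`, `N(ν) = n`, `Im(μ·ν⁴) = 1` and `Re(μ·ν⁴) = t` — a solution of the harmonic quartic Thue
equation attached to `μ` (cf. `…HarmonicThue.im_pow_four_mul`). [folklore] -/
theorem thueSolution_of_cell {t m n : ℕ} (h : 1 + t ^ 2 = m * n ^ 4) :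
    ∃ μ ν : GaussianInt, μ.norm = m ∧ ν.norm = n ∧ (μ * ν ^ 4).im = 1 ∧ (μ * ν ^ 4).re = t := by
  obtain ⟨μ, ν, hμ, hν, hα⟩ := gaussianNormalForm t m n h
  exact ⟨μ, ν, hμ, hν, by rw [← hα], by rw [← hα]⟩

end Summit.ABC.ABC.Theorems.UniformSadicTowerFour.GaussianNormalForm
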